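import Mathlib.Analysis.InnerProductSpace.PiL2
import Mathlib.Analysis.Normed.Operator.LinearIsometry
import Mathlib.Tactic
import Literature.MathematicalPhysics.StatisticalMechanics.BarlowStacking
import Literature.MathematicalPhysics.StatisticalMechanics.HaggStacking

/-!
# Crux `HcpLandscapeGap` (route `HullExactificationCascade`, stmt-AtomisticToContinuum-12087),
# line `birth`: stub `stub_periodiseWindow` (PW) — periodising the Hägg word behind a window

Potential-free bookkeeping for windows of exact rigid images of uniform Barlow stackings.  The
part of `v + B '' barlowStacking a h s` (`B` a linear isometry, `0 < h`, `s` a Hägg word) inside a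
closed ball `dist · c ≤ L` coincides with that of `v + B '' barlowStacking a h s'` for a PERIODIC
Hägg word `s'`:

* a stacking point `w = barlowPos a h s k i j` with `dist (v + B w) c ≤ L` lies on a layer with
  `|k| h = |w 2| ≤ ‖w‖ = ‖B w‖ = dist (v + B w) v ≤ L + dist v c`, so only the layers `|k| ≤ N`,
  `(L + dist v c) / h ≤ N`, meet the ball (`abs_layer_le_of_dist_le`);
* the layer labels `haggLabel s k`, `|k| ≤ N`, are (signed) sums of `s` over sub-intervals of
  `[-N, N)` (`haggLabel_natCast`, `haggLabel_neg_natCast`), so they only depend on `s` there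
  (`haggLabel_eq_of_eq_on_window`), and `barlowPos a h s k i j` depends on `s` only through
  `haggLabel s k`;
* the `(2N + 1)`-periodic word `s' k = s (((k + N) mod (2N + 1)) - N)` takes the values of `s`
  (so it is a Hägg word) and agrees with `s` on `[-N, N]`.

All `[folklore]`.
-/

noncomputable section

namespace Summit.AtomisticToContinuum.Crystallization.Theorems.HcpLandscapeGapBirth

open Literature.MathematicalPhysics.StatisticalMechanics

/-- **Layer labels are local.** If two words agree on `[-N, N)` then their layer labels
`haggLabel` agree on every layer `|k| ≤ N`: `haggLabel s k` is the sum of `s` over `[0, k)` for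
`k ≥ 0` and minus the sum over `[k, 0)` for `k < 0`. [folklore] -/
theorem haggLabel_eq_of_eq_on_window {s s' : ℤ → ℤ} {N : ℕ}
    (hss' : ∀ i : ℤ, -(N : ℤ) ≤ i → i < N → s i = s' i) {k : ℤ} (hk : |k| ≤ N) :
    haggLabel s k = haggLabel s' k := by
  rw [abs_le] at hk
  rcases le_or_gt 0 k with h0 | h0
  · lift k to ℕ using h0
    simp only [haggLabel_natCast, haggWindow]
    refine Finset.sum_congr rfl fun i hi => ?_
    have hi' := Finset.mem_range.1 hi
    exact hss' _ (by omega) (by omega)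
  · obtain ⟨n, rfl⟩ : ∃ n : ℕ, k = -(n : ℤ) := ⟨(-k).toNat, by omega⟩
    rw [haggLabel_neg_natCast, haggLabel_neg_natCast]
    simp only [haggWindow]
    congr 1
    refine Finset.sum_congr rfl fun i hi => ?_
    have hi' := Finset.mem_range.1 hi
    exact hss' _ (by omega) (by omega)

/-- **Only finitely many layers meet a ball.** If the rigid image `v + B w` of the stacking point
`w = barlowPos a h s k i j` (`0 < h`, `B` a linear isometry) lies in the closed ball
`dist · c ≤ L`, then `|k| ≤ (L + dist v c) / h`:
`|k| h = |w 2| ≤ ‖w‖ = ‖B w‖ = dist (v + B w) v ≤ dist (v + B w) c + dist c v`. [folklore] -/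
theorem abs_layer_le_of_dist_le {a h : ℝ} (hh : 0 < h) (s : ℤ → ℤ)
    (B : EuclideanSpace ℝ (Fin 3) →ₗᵢ[ℝ] EuclideanSpace ℝ (Fin 3)) (v c : EuclideanSpace ℝ (Fin 3))
    {L : ℝ} {k i j : ℤ} (hy : dist (v + B (barlowPos a h s k i j)) c ≤ L) :
    |(k : ℝ)| ≤ (L + dist v c) / h := by
  rw [le_div_iff₀ hh]
  have h1 : |(k : ℝ) * h| ≤ ‖barlowPos a h s k i j‖ := by
    have h0 := PiLp.norm_apply_le (barlowPos a h s k i j) 2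
    rwa [barlowPos_apply_two, Real.norm_eq_abs] at h0
  rw [abs_mul, abs_of_pos hh, ← B.norm_map] at h1
  have h2 : ‖B (barlowPos a h s k i j)‖ = dist (v + B (barlowPos a h s k i j)) v := by
    rw [dist_eq_norm, add_sub_cancel_left]
  have h3 := dist_triangle (v + B (barlowPos a h s k i j)) c v
  rw [dist_comm c v] at h3
  linarith

/-- **Stub PW — periodising the word behind a window.** For `0 < h`, a Hägg word `s`, a linear
isometry `B`, vectors `v, c` and a radius `L`, there is a periodic Hägg word `s'` (period
`2N + 1` with `(L + dist v c) / h ≤ N`, `s' k = s (((k + N) mod (2N + 1)) - N)`) such that the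
windows `{y ∈ v + B '' barlowStacking a h s | dist y c ≤ L}` and
`{y ∈ v + B '' barlowStacking a h s' | dist y c ≤ L}` coincide: a stacking point of either
stacking whose image lies in the ball sits on a layer `|k| ≤ N` (`abs_layer_le_of_dist_le`), the
two words agree on `[-N, N]`, hence so do the labels of these layers
(`haggLabel_eq_of_eq_on_window`) and the points `barlowPos a h · k i j` themselves. [folklore] -/
theorem stub_periodiseWindow : (∀ (a h : ℝ), 0 < h → ∀ s : ℤ → ℤ, Literature.MathematicalPhysics.StatisticalMechanics.IsHaggSeq s → ∀ (B : EuclideanSpace ℝ (Fin 3) →ₗᵢ[ℝ] EuclideanSpace ℝ (Fin 3)) (v c : EuclideanSpace ℝ (Fin 3)) (L : ℝ), ∃ (s' : ℤ → ℤ) (p : ℕ), p ≠ 0 ∧ (∀ i : ℤ, s' (i + p) = s' i) ∧ Literature.MathematicalPhysics.StatisticalMechanics.IsHaggSeq s' ∧ {y : EuclideanSpace ℝ (Fin 3) | y ∈ (fun w => v + B w) '' Literature.MathematicalPhysics.StatisticalMechanics.barlowStacking a h s ∧ dist y c ≤ L} = {y : EuclideanSpace ℝ (Fin 3) | y ∈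 (fun w => v + B w) '' Literature.MathematicalPhysics.StatisticalMechanics.barlowStacking a h s' ∧ dist y c ≤ L}) := by
  intro a h hh s hs B v c L
  -- only the layers `|k| ≤ N` can meet the ball, for either word
  obtain ⟨N, hN⟩ : ∃ N : ℕ, (L + dist v c) / h ≤ N := ⟨_, Nat.le_ceil _⟩
  have hlayer : ∀ (t : ℤ → ℤ) (k i j : ℤ), dist (v + B (barlowPos a h t k i j)) c ≤ L →
      |k| ≤ (N : ℤ) := by
    intro t k i j hy
    have h1 : |(k : ℝ)| ≤ N := (abs_layer_le_of_dist_le hh t B v c hy).trans hN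
    exact_mod_cast h1
  -- the periodised word: period `P = 2N + 1`, `s' k = s (((k + N) mod P) - N)`
  obtain ⟨P, hP⟩ : ∃ P : ℕ, P = 2 * N + 1 := ⟨_, rfl⟩
  obtain ⟨s', hs'⟩ : ∃ s' : ℤ → ℤ, ∀ k : ℤ, s' k = s ((k + N) % (P : ℤ) - N) :=
    ⟨fun k => s ((k + N) % (P : ℤ) - N), fun _ => rfl⟩
  refine ⟨s', P, by omega, fun k => ?_, ?_, ?_⟩
  · -- periodicity
    rw [hs', hs', add_right_comm, Int.add_emod_right]
  · -- `s'` takes the values of `s`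
    intro k
    rw [hs']
    exact hs _
  · -- agreement of the words on `[-N, N]`, hence of the labels and points of the layers `|k| ≤ N`
    have hagree : ∀ i : ℤ, -(N : ℤ) ≤ i → i < N → s i = s' i := by
      intro i h1 h2
      have h3 : (i + N) % (P : ℤ) = i + N := Int.emod_eq_of_lt (by omega) (by omega)
      rw [hs', h3, add_sub_cancel_right]
    have hpos : ∀ k i j : ℤ, |k| ≤ (N : ℤ) → barlowPos a h s k i j = barlowPos a h s' k i j := by
      intro k i j hk
      simp only [barlowPos]
      rw [haggLabel_eq_of_eq_on_window hagree hk]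
    ext y
    simp only [Set.mem_setOf_eq, Set.mem_image, mem_barlowStacking_iff]
    constructor
    · rintro ⟨⟨w, ⟨k, i, j, rfl⟩, rfl⟩, hy⟩
      exact ⟨⟨barlowPos a h s' k i j, ⟨k, i, j, rfl⟩, by rw [hpos k i j (hlayer s k i j hy)]⟩, hy⟩
    · rintro ⟨⟨w, ⟨k, i, j, rfl⟩, rfl⟩, hy⟩
      exact ⟨⟨barlowPos a h s k i j, ⟨k, i, j, rfl⟩, by rw [hpos k i j (hlayer s' k i j hy)]⟩, hy⟩

end Summit.AtomisticToContinuum.Crystallization.Theorems.HcpLandscapeGapBirth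

end
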